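import Summits.Ventures.HSemireg.HomComplexSigma
import Summits.Ventures.HSemireg.ComponentCellsRouteC
import Literature.AlgebraicGeometry.Modules.ExtCohomologyComparison
import HarnessLib

/-!
# Venture HSemireg — the perfect-complex door with the SEMIREGULARITY hypothesis on a real carrier:
# «`{1..n} ⊆ I`, `Ext^{<0}(E,E) = 0`, `Hom(E,E) = ℂ`, and `(σ_q)_{q+1 ∈ I}` jointly injective on `Ext²(E•,E•)`»

HONEST FRAMING. Part of the Lean index of the computation cell `pub-hsemireg` (target seat t-7; venture side of the K2-MIN chain).
Nothing here is a claim about any explicit variety; nothing here says that HC / HC_CM / HC_AV holds; no Literature fact is declared;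
nothing is asserted — every transfer statement is a HYPOTHESIS BY NAME and every seed a hypothesis BY VALUE.

WHAT THIS FILE ADDS. `PerfectComplexDoor.lean` (seat p4) made the transfer «admissible perfect complex at one fibre ⟹ its Chern
character stays algebraic nearby» a SCHEMA `PerfectComplexVariationalHodge C Adm` in an admissibility notion `Adm`, and recorded
(module docstring, item 4) that the INTENDED notion — «`{1..n} ⊆ I`, `Ext^{<0}_{D(X₀)}(E,E) = 0`, `E` simple, and the
Buchweitz–Flenner semiregularity map of the perfect complex `E` injective» — had no carrier in the tree: the semiregularity map
of a COMPLEX was untyped.  `PerfectComplexRankDoor.lean` (p4, TIER 2) therefore typed the SUFFICIENT condition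
`rank Ext² ≤ r(A, ch E)` of [BuchweitzFlenner2008HH, Prop. 6.4.4] instead (`rankAdmissible C`, `PerfectComplexRankTransfer C`).
Since then the cell's K2-MIN chain landed the semiregularity map of a strictly perfect complex ON REAL CARRIERS:
`HomComplex.sigmaC X K a b hK q : Hom_D(Q K•, (Q K•)⟦2⟧) → Hom_D(Q 𝒪_X[0], (Q Ω^q[0])⟦q+2⟧)`,
`σ_q(x) = Q(unit) ≫ Φ_K(x · ι• · At(K•)^q) ≫ Q(Tr•)⟦q+2⟧` (`HomComplexSigma.lean`, over `HomComplex*.lean`, `DerivedDescent.lean`,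
`HomComplexUnit.lean`, `HomComplexSupertrace.lean`, `ComplexAtiyahClass.lean`; [BuchweitzFlenner2003, Def. 4.1] WITHOUT the scalars `(-1)^q/q!`, which do
not change injectivity), and `HomComplex.IsISemiregularC X K a b hK I` := joint injectivity of `(σ_q)_{q ∈ I}`.  This file types the
intended notion itself:

0. (complement to `HomComplexSigma.lean`) `HomComplex.sigmaCoh_eq_zero_of_sigmaC_eq_zero`, `sigmaC_eq_zero_of_sigmaCoh_eq_zero`,
   `IsISemiregularC.of_coh`, `isISemiregularC_iff_coh`: `IsISemiregularC` ⟺ the COHOMOLOGICAL joint-kernel condition («`σ_q(x) = 0 ∈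
   H^{q+2}(X, Ω^q)` for all `q ∈ I` ⟹ `x = 0`») — the shape of the module-level `IsISemiregular`; uses the tree's
   `extToCohomology_bijective` (Hartshorne III.6.3 (c)) and Mathlib's `Ext.homAddEquiv`.
1. `sigmaAdmissible : AdmissibilityNotion` — «`{1..n} ⊆ I`; `Ext^{k}(E,E) = 0` for `k < 0` and `Hom(E,E) = ℂ` (CARDINAL ranks in
   Mathlib's derived category, p4's `extRank`); `E` concentrated in `[a, b]` with finite locally free terms; and
   `IsISemiregularC X₀ E a b hE {q | q + 1 ∈ I}`» (all in `DerivedCategory X₀.left.Modules` for the constructed instance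
   `HasDerivedCategory.standard`, as `extRank`).  Every conjunct is a definition of the tree / Mathlib on real carriers.
2. `PerfectComplexSigmaTransfer C := PerfectComplexVariationalHodge C sigmaAdmissible` — the transfer statement for
   `I`-SEMIREGULAR perfect complexes with `Ext^{<0} = 0`, `Hom = ℂ`.  STATUS: an ASSUMPTION BY NAME of the venture (hypothesis of the
   consumers below), now OF EXACTLY PRINTED SHAPE on the object side: its hypothesis is the printed one («`E` semiregular,
   `Ext^{<0}(E,E) = 0`», Perry arXiv:2604.00511 Thm. 1.1 second bullet with `B₀ = 0` — preprint, claim-grade; refereed: [Perry2022]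
   Prop. 8.1 + the local half (L1)–(L6) of the cell's `theory/TH2-ASSEMBLY-NOTE-2PAGE.md` §3: [Lieblich2006] Thm. 4.2.1,
   [Pridham2024Semiregularity] Lemma 1.8 / Cor. 2.25 / Rem. 2.27 / Rem. 2.21, [BuchweitzFlenner2003] Rem. 4.7 (1), [Deligne1968]
   Thm. 5.5), in the LOCAL form of `PerfectComplexDoor.lean` (Hodge hypothesis and conclusion near `s₀`; smooth projective family over
   a smooth base).  No declaration of the tree discharges it.  Residual conventions between `sigmaC` and the printed `σ`: the omitted
   scalars `(-1)^q/q!` and the sign convention of the supertrace — automorphisms of the targets `H^{q+2}(X₀, Ω^q)`, so the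
   admissible objects are the same.
3. The FACTORISATION of p4's TIER-2 assumption: `PerfectComplexSigmaTransfer C` together with «`rankAdmissible C ⟹ sigmaAdmissible`»
   gives `PerfectComplexRankTransfer C` (`perfectComplexRankTransfer_of_sigmaTransfer`, monotonicity of the schema).  The implication
   «rank clause ⟹ semiregular» is [BuchweitzFlenner2008HH] Prop. 6.4.4 (`σ_F ∘ c_F = (ξ ↦ ξ ⌟ ch F)`) plus the rank squeeze
   `r ≤ rank σ ≤ dim Ext² ≤ r` — ON PAPER (it is a hypothesis of that theorem here, not a kernel fact: the identification of
   `σ ∘ c` with the contraction against `ch` is not in the tree).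
4. Consumers, one line each over the door-agnostic theorems of `ComponentCellsRouteC.lean` / `AmplificationChainAssembly.lean`:
   the cell form `weilClassesComponent_of_perfectComplexSigmaTransfer_of_seedOn_member` (any `(n, d, δ)`), the `g = 6` TARGET-TABLE
   template `weilSixfoldComponent_of_perfectComplexSigmaTransfer_of_seedOn_member`, and `g = 4`
   `weilFourfoldsSplit_of_reach_of_perfectComplexSigmaTransfer_of_hyperbolicSeedOn`; plus the two rows UNBUNDLED (every binder
   a real carrier: `E`, bounds, `extRank` clauses, `IsISemiregularC`, the `ch` identities) —
   `weilSixfoldComponent_of_perfectComplexSigmaTransfer_of_complex`, `weilFourfoldsSplit_of_reach_of_perfectComplexSigmaTransfer_of_complex`.  A seed of class `sigmaObjClass C` asks, BY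
   VALUE, for an `I`-semiregular bounded complex of vector bundles on the member — a hypothesis no census computation discharges in
   the kernel (the engines compute `σ`-ranks numerically); exactly as for the rank class.

NOT here: `bfAdmissible ⟹ sigmaAdmissible` (needs the comparison `σ_q^C(E₀[0]) = σ_q(E₀)` of the column case — seat gs-g4's
assembly (A1)–(A4), the K2 anchor); the `μ₂`-twisted variant; any seed; any claim about `PerfectComplexSigmaTransfer`.  Remark
(seat p7): `VoisinBarrierFor C sigmaAdmissible` (`VoisinBarrier.lean` §4 schema) becomes, with this notion, a statement WITH a carrier
— still not covered by that note's proof.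
[cite: BuchweitzFlenner2003, Def. 4.1 and §5 (I-semiregular)] [cite: BuchweitzFlenner2008HH, Prop. 6.4.4]
[cite: Perry2022, Prop. 8.1] [cite: Lieblich2006, Thm. 4.2.1] [cite: Pridham2024Semiregularity, Cor. 2.25, Rem. 2.27]
-/

noncomputable section

open CategoryTheory CategoryTheory.Limits AlgebraicGeometry

namespace Summit.Ventures.HSemireg

open Literature.AlgebraicGeometry Literature.AlgebraicGeometry.Motives Literature.AlgebraicGeometry.Modules
open Literature.AlgebraicGeometry.HodgeTheory Literature.AlgebraicGeometry.KTheory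
open Literature.AlgebraicGeometry.VanGeemen1994
open Literature.AlgebraicTopology.SingularHomology
open Summit.HodgeConjecture.HodgeConjecture.Ring2.Hypotheses
open Summit.HodgeConjecture.HodgeConjecture.Ring2.AbelianAll

/-! ### 0. Complement to `HomComplexSigma.lean`: the cohomological form of the joint-kernel condition -/

namespace HomComplex

section Coh

universe w₁ u₁

variable {S : Type u₁} [CommRing S] (X : Over (Spec (CommRingCat.of S))) [HasDerivedCategory.{w₁} X.left.Modules]
  (K : CochainComplex X.left.Modules ℤ) (a b : ℤ) [K.IsStrictlyGE a] [K.IsStrictlyLE b]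
  (hK : ∀ p, IsFiniteLocallyFree (K.X p))

/-- `σ_q(x) = 0` in `Hom_D(Q 𝒪_X[0], (Q Ω^q[0])⟦q+2⟧)` forces the class `σ_q(x) = 0` in `H^{q+2}(X, Ω^q)` (both comparison maps
`Ext.homEquiv.symm` and `extToCohomology` are additive). [cite: BuchweitzFlenner2003, Def. 4.1] -/
theorem sigmaCoh_eq_zero_of_sigmaC_eq_zero (q : ℕ) (x : ShiftedHom (DerivedCategory.Q.obj K) (DerivedCategory.Q.obj K) (2 : ℤ))
    (h : sigmaC X K a b hK q x = 0) : sigmaCoh X K a b hK q x = 0 := by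
  have h' : sigmaExt X K a b hK q x = 0 := by
    change Abelian.Ext.homAddEquiv.symm (sigmaC X K a b hK q x) = 0
    rw [h]
    exact map_zero Abelian.Ext.homAddEquiv.symm
  change Literature.AlgebraicGeometry.HodgeTheory.extToCohomology (hodgeSheaf X q) (q + 2) (sigmaExt X K a b hK q x) = 0
  rw [h', map_zero]

/-- **The cohomological joint-kernel condition implies `I`-semiregularity**: if `σ_q(x) = 0 ∈ H^{q+2}(X, Ω^q)` for all `q ∈ I`
forces `x = 0`, then `(σ_q)_{q ∈ I}` is jointly injective on `Ext²(K•, K•)` (this direction uses only additivity of the comparison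
maps). [cite: BuchweitzFlenner2003, §5 (I-semiregular)] -/
theorem IsISemiregularC.of_coh (I : Set ℕ)
    (h : ∀ x : ShiftedHom (DerivedCategory.Q.obj K) (DerivedCategory.Q.obj K) (2 : ℤ),
      (∀ q ∈ I, sigmaCoh X K a b hK q x = 0) → x = 0) :
    IsISemiregularC X K a b hK I :=
  (isISemiregularC_iff_ker X K a b hK I).2 fun x hx => h x fun q hq => sigmaCoh_eq_zero_of_sigmaC_eq_zero X K a b hK q x (hx q hq)

/-- `σ_q(x) = 0` in `H^{q+2}(X, Ω^q)` forces `σ_q(x) = 0` in `Hom_D`: both comparison maps are injective — `Ext.homEquiv` is a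
bijection (Mathlib) and `Ext^i_{𝒪_X}(𝒪_X, G) → H^i(X, G)` is bijective (the tree's `extToCohomology_bijective`, Hartshorne
III.6.3 (c)). [cite: Hartshorne1977, III Prop. 6.3 (c)] -/
theorem sigmaC_eq_zero_of_sigmaCoh_eq_zero (q : ℕ) (x : ShiftedHom (DerivedCategory.Q.obj K) (DerivedCategory.Q.obj K) (2 : ℤ))
    (h : sigmaCoh X K a b hK q x = 0) : sigmaC X K a b hK q x = 0 := by
  have h1 : sigmaExt X K a b hK q x = 0 :=
    (Literature.AlgebraicGeometry.Modules.extToCohomology_bijective (hodgeSheaf X q) (q + 2)).1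
      (h.trans (map_zero _).symm)
  have h2 : Abelian.Ext.homAddEquiv.symm (sigmaC X K a b hK q x) =
      Abelian.Ext.homAddEquiv.symm (0 : ShiftedHom (DerivedCategory.Q.obj ((HomologicalComplex.single X.left.Modules
        (ComplexShape.up ℤ) 0).obj (unitModule X.left))) (DerivedCategory.Q.obj ((HomologicalComplex.single X.left.Modules
        (ComplexShape.up ℤ) 0).obj (hodgeSheaf X q))) ((q + 2 : ℕ) : ℤ)) :=
    h1.trans (map_zero Abelian.Ext.homAddEquiv.symm).symm
  exact Abelian.Ext.homAddEquiv.symm.injective h2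

/-- **`I`-semiregularity of a strictly perfect complex, COHOMOLOGICAL form**: `(σ_q)_{q ∈ I}` is jointly injective on `Ext²(K•, K•)`
iff `σ_q(x) = 0 ∈ H^{q+2}(X, Ω^q)` for all `q ∈ I` forces `x = 0` — the exact shape of the tree's module-level `IsISemiregular`
(cohomology-valued `sigmaHigher`), so the two notions can be compared term by term once `σ_q^C(E₀[0]) = σ_q(E₀)` (the column
anchor, seat gs-g4) is in the tree. [cite: BuchweitzFlenner2003, §5 (I-semiregular)] [cite: Hartshorne1977, III Prop. 6.3 (c)] -/
theorem isISemiregularC_iff_coh (I : Set ℕ) :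
    IsISemiregularC X K a b hK I ↔
      ∀ x : ShiftedHom (DerivedCategory.Q.obj K) (DerivedCategory.Q.obj K) (2 : ℤ),
        (∀ q ∈ I, sigmaCoh X K a b hK q x = 0) → x = 0 :=
  ⟨fun h x hx => (isISemiregularC_iff_ker X K a b hK I).1 h x fun q hq =>
      sigmaC_eq_zero_of_sigmaCoh_eq_zero X K a b hK q x (hx q hq),
    IsISemiregularC.of_coh X K a b hK I⟩

end Coh

end HomComplex

/-! ### 1. The semiregularity admissibility notion (real carriers) -/

section Notion

/-- **The semiregularity admissibility notion** (TYPED, every conjunct a definition of the tree / Mathlib on real carriers):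
a cochain complex `E` of `𝒪_{X₀}`-modules is admissible for `(n, X₀, I)` iff
(i) `I` contains every Chern degree `1 ≤ p ≤ n`;
(ii) `Ext^{k}_{D(X₀)}(E, E) = 0` for `k < 0` (Lieblich's «universally gluable») and `Hom_{D(X₀)}(E, E) = ℂ` (simple), as
CARDINAL ranks (`extRank`, seat p4);
(iii) `E` is concentrated in degrees `[a, b]` with every term finite locally free (a strictly perfect complex) and the part
`(σ_q)_{q + 1 ∈ I}` of its semiregularity map is JOINTLY INJECTIVE on `Ext²(E, E) = Hom_{D(X₀)}(Q E, (Q E)⟦2⟧)`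
(`HomComplex.IsISemiregularC`, the cell's `σ_q` of a strictly perfect complex on real carriers, [BF03] Def. 4.1 without the
scalars `(-1)^q/q!`) — in Mathlib's derived category of ALL `𝒪_{X₀}`-modules for the constructed instance
`HasDerivedCategory.standard` (the instance of `extRank`).  This is the INTENDED notion of `PerfectComplexDoor.lean` (module
docstring, item 4) with BF's `I`-semiregularity ([BF03] §5, the hypothesis of their Thm. 5.1) as the semiregularity clause.
INDEX SET (th-2, bus 2026-08-22T15:06:34Z): under clause (i) `{1, …, n} ⊆ I` with `n = dim X₀` the set `{q | q + 1 ∈ I}` contains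
`0, …, n - 1`, i.e. every `q` whose target `H^{q+2}(X₀, Ω^q)` can be non-zero (`q ≤ n - 2`), so `IsISemiregularC` HERE is injectivity
of the FULL semiregularity map — the hypothesis printed in [BF03] Thm. 5.1 / [Pridham2024] Cor. 2.25 + Rem. 2.27 / Perry Thm. 1.1;
for a smaller `I`, BF's `I`-semiregularity is a STRONGER injectivity requirement (fewer components must already separate), not a
weaker one.  VACUITY (red-1 V13, kernel probe P3): a complex with `Ext²(E, E)` a subsingleton satisfies clause (iii) for every `I` —
correctly so (such an object is unobstructed); the content of a SEED is then carried by the Chern-character clause of `HasSeedOn`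
(`κ_n = q·hⁿ + w`, `w ≠ 0` a Weil class), never by (iii) alone.  SCALARS: over the base `ℂ` of this door the omitted factors
`(-1)^q/q!` of [BF03] Def. 4.1 are units, so (iii) is BF's condition; over a general base it would be a different map.
[cite: BuchweitzFlenner2003, Def. 4.1 and §5 (I-semiregular)] [cite: Lieblich2006, Thm. 4.2.1 (universally gluable)]
[cite: Perry2026Semiregularity, Thm. 1.1 (hypotheses «semiregular», «Ext^{<0} = 0»)] -/
def sigmaAdmissible : AdmissibilityNotion := fun n X₀ I E =>
  (∀ p : ℕ, 1 ≤ p → p ≤ n → p ∈ I) ∧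
    (∀ k : ℤ, k < 0 → extRank X₀ E k = 0) ∧ extRank X₀ E 0 = 1 ∧
      ∃ (a b : ℤ) (_ : E.IsStrictlyGE a) (_ : E.IsStrictlyLE b) (hE : ∀ i, IsFiniteLocallyFree (E.X i)),
        letI := HasDerivedCategory.standard X₀.left.Modules
        HomComplex.IsISemiregularC X₀ E a b hE {q | q + 1 ∈ I}

/-- The object class of the semiregularity door: `perfectObjClass C sigmaAdmissible`, i.e. «`κ|_I = ch(E)|_I` for a bounded
complex of vector bundles `E` on `X₀` with `Ext^{<0}(E,E) = 0`, `Hom(E,E) = ℂ`, `(σ_q)_{q+1 ∈ I}` jointly injective», `{1..n} ⊆ I`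
— the hypothesis on `E₀` in Perry's Thm. 1.1 with `B₀ = 0`, for `I`-semiregularity.
[cite: BuchweitzFlenner2003, Def. 4.1 and §5] [cite: Perry2026Semiregularity, Thm. 1.1 (hypotheses)] -/
abbrev sigmaObjClass (C : ChernCharacterBetti) (n : ℕ) (X₀ : SchemeOver ℂ) (I : Finset ℕ)
    (κ : ∀ p : ℕ, complexBetti X₀ (2 * p)) : Prop :=
  perfectObjClass C sigmaAdmissible n X₀ I κ

end Notion

/-! ### 2. The named transfer statement and its bookkeeping -/

section Door

/-- **The perfect-complex transfer over the semiregularity class** — `PerfectComplexVariationalHodge C sigmaAdmissible`: along a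
smooth projective family over a smooth base, the Chern character (degrees `p ∈ I ⊇ {1..n}`) of a bounded complex of vector
bundles `E` on a fibre `X₀` with `Ext^{<0}(E,E) = 0`, `Hom(E,E) = ℂ` and `(σ_q)_{q+1 ∈ I}` jointly injective, if it stays Hodge
along the paths of a cohomologically locally trivial `U`, stays ALGEBRAIC on the fibres near `X₀` (exact binders:
`PerfectComplexVariationalHodge`).  STATUS: an ASSUMPTION BY NAME of the venture (hypothesis of the theorems below), whose object
hypothesis is now the PRINTED one on a real carrier; in print it is the local form of Perry's Thm. 1.1 (second bullet, `B₀ = 0`;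
preprint, claim-grade) and, refereed, of [Perry2022] Prop. 8.1 + the local half (L1)–(L6) ([Lieblich2006] 4.2.1;
[Pridham2024Semiregularity] Lemma 1.8, Cor. 2.25, Rem. 2.27, Rem. 2.21; [BuchweitzFlenner2003] Rem. 4.7 (1); [Deligne1968] Thm. 5.5)
— derivation of the local form in the module docstring of `PerfectComplexDoor.lean`.  No declaration of the tree discharges it.
[claim: Perry2026Semiregularity, status: under-review] [cite: Perry2022, Prop. 8.1]
[cite: Pridham2024Semiregularity, Cor. 2.25, Rem. 2.27, Rem. 2.21, Lemma 1.8] [cite: Lieblich2006, Thm. 4.2.1]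
[cite: BuchweitzFlenner2003, Def. 4.1, §5 and Rem. 4.7 (1)] [cite: Deligne1968, Thm. 5.5] -/
def PerfectComplexSigmaTransfer (C : ChernCharacterBetti) : Prop :=
  PerfectComplexVariationalHodge C sigmaAdmissible

/-- Unfolding: the semiregularity transfer is the schema of `PerfectComplexDoor.lean` at `Adm := sigmaAdmissible`. [folklore] -/
theorem perfectComplexSigmaTransfer_iff (C : ChernCharacterBetti) :
    PerfectComplexSigmaTransfer C ↔ PerfectComplexVariationalHodge C sigmaAdmissible :=
  Iff.rfl

/-- **The semiregularity transfer IS the local variational statement for the semiregularity object class** (binder shuffle of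
`AmplificationChainG4RouteC.lean` §1). [cite: BuchweitzFlenner2003, §5 Thm. 5.1 (binder shape)] -/
theorem PerfectComplexSigmaTransfer.localVariationalHodgeFor {C : ChernCharacterBetti} (h : PerfectComplexSigmaTransfer C) :
    LocalVariationalHodgeFor (sigmaObjClass C) :=
  PerfectComplexVariationalHodge.localVariationalHodgeFor ((perfectComplexSigmaTransfer_iff C).1 h)

/-- **Any transfer statement for a WIDER admissibility notion serves the semiregularity class**: if `Adm` admits every
`sigmaAdmissible` complex, then `PerfectComplexVariationalHodge C Adm` implies `PerfectComplexSigmaTransfer C`. [folklore] -/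
theorem perfectComplexSigmaTransfer_of_wider {C : ChernCharacterBetti} {Adm : AdmissibilityNotion}
    (hle : ∀ n X₀ I E, sigmaAdmissible n X₀ I E → Adm n X₀ I E) (h : PerfectComplexVariationalHodge C Adm) :
    PerfectComplexSigmaTransfer C :=
  h.anti hle

/-- **Factorisation of the TIER-2 assumption.**  GIVEN «rank clause ⟹ semiregular» — `rankAdmissible C n X₀ I E →
sigmaAdmissible n X₀ I E` for all `(n, X₀, I, E)`: ON PAPER this is [BuchweitzFlenner2008HH] Prop. 6.4.4 (`σ_F (c_F ξ) = ξ ⌟ ch F`)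
with the squeeze `r(A, ch E) ≤ rank σ_E ≤ rank Ext²(E,E) ≤ r(A, ch E)`; it is a HYPOTHESIS here (the identification of `σ ∘ c`
with the contraction against the Chern character is not a kernel statement) — the semiregularity transfer implies p4's rank
transfer `PerfectComplexRankTransfer C`.  So the venture's assumption of record splits into a printed-shape transfer on a real
`σ`-carrier and a printed identity on the same carrier. [cite: BuchweitzFlenner2008HH, Prop. 6.4.4]
[cite: BuchweitzFlenner2003, Def. 4.1] -/
theorem perfectComplexRankTransfer_of_sigmaTransfer {C : ChernCharacterBetti}
    (himp : ∀ n X₀ I E, rankAdmissible C n X₀ I E → sigmaAdmissible n X₀ I E) (h : PerfectComplexSigmaTransfer C) :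
    PerfectComplexRankTransfer C :=
  (perfectComplexRankTransfer_iff C).2 (PerfectComplexVariationalHodge.anti himp ((perfectComplexSigmaTransfer_iff C).1 h))

end Door

/-! ### 3. Consumers: cell form, the `g = 6` template, `g = 4` -/

section Consumers

open Summit.HodgeConjecture.HodgeConjecture
open Summit.HodgeConjecture.HodgeConjecture.WeilTypeLadder
open Summit.HodgeConjecture.HodgeConjecture.Cruxes.HodgeAbelianVarieties.EStepSecantInduction
open Summit.Ventures.HSemireg.GeneralStructure

/-- **Route (C) over the semiregularity class, cell form `(n, d, δ)`.** Hypotheses BY NAME: `weilFamilyReach_similar` (REFEREED fact)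
and `PerfectComplexSigmaTransfer C` (ASSUMPTION of the venture, printed object hypothesis on a real carrier).  Hypotheses BY VALUE: a
polarized Weil-type `(n, d)` member of the cell `δ`, a non-zero rational Weil class `w` on it, and ONE seed of class `sigmaObjClass C`
on it — an `I`-semiregular (`{1..2n} ⊆ I`, `q + 1 ∈ I`) bounded complex of vector bundles with `Ext^{<0} = 0`, `Hom = ℂ`,
`ch_n = q·h_Kⁿ + w`, `ch_p = c_p·h_Kᵖ` off `n`.  Conclusion: `WeilClassesComponent n d δ`.  Nothing asserted.  (Citation scope: the
transfer for a COMPLEX is, in print, Pridham 2024 Cor. 2.25 / Rem. 2.27 + Perry 2022 Prop. 8.1 — Perry 2026 Thm. 1.1 as a preprint;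
BF 2003 enters only through Def. 4.1 (`σ`) and §5 (the `I`-semiregularity notion), NOT through its Thm. 5.1, which is the sheaf case.)
[claim: Perry2026Semiregularity, status: under-review] [cite: Perry2022, Prop. 8.1] [cite: Pridham2024Semiregularity, Cor. 2.25, Rem. 2.27]
[cite: BuchweitzFlenner2003, Def. 4.1 and §5 (I-semiregular)] [cite: Deligne1982HodgeCycles, proof of Thm. 4.8] -/
theorem weilClassesComponent_of_perfectComplexSigmaTransfer_of_seedOn_member (C : ChernCharacterBetti) {n d : ℕ}
    {δ : weilNormResidueGroup d} (hF : weilFamilyReach_similar) (hT : PerfectComplexSigmaTransfer C)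
    {P : AbelianVariety ℂ} {ψ₀ : P ⟶ P} (hW : IsWeilType P ψ₀ n d) (e : ProjectiveEmbedding P.X)
    {a : complexBetti (projectiveSpace e.n ℂ) 2} (haQ : IsRationalClass a) (ha0 : a ≠ 0)
    (hδ : HasWeilDiscriminantNondeg P ψ₀ n d (symmetrisedClass d P ψ₀ e a) δ)
    {w : complexBetti P.X (2 * n)} (hwW : w ∈ weilClassesOf P ψ₀ n d) (hwQ : IsRationalClass w) (hw0 : w ≠ 0)
    (hS : HasSeedOn (sigmaObjClass C) n P (symmetrisedClass d P ψ₀ e a) w) :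
    WeilClassesComponent n d δ :=
  weilClassesComponent_of_localVariationalHodgeFor_of_seedOn_member hF hT.localVariationalHodgeFor hW e haQ ha0 hδ
    hwW hwQ hw0 hS

/-- **`g = 6`, route (C) over the semiregularity class — the TARGET-TABLE template for a perfect-complex row whose certificate is
SEMIREGULARITY itself.**  Granting BY NAME `weilFamilyReach_similar` (REFEREED) and `PerfectComplexSigmaTransfer C` (ASSUMPTION):
a Weil-type `(3, d)` member `(P, ψ₀, h_K)` of the sixfold cell `δ` with its Gram placement, a non-zero rational Weil class
`w ∈ W_K`, and ONE bounded complex of vector bundles `E•` on `P` with `{1,…,6} ⊆ I`, `Ext^{<0}(E•,E•) = 0`, `Hom(E•,E•) = ℂ`,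
`(σ_q(E•))_{q+1 ∈ I}` jointly injective (`HomComplex.IsISemiregularC`), `ch₃(E•) = q·h_K³ + w`, `ch_p(E•) = c_p·h_Kᵖ`
(`p ∈ I ∖ {3}`) — packaged as `HasSeedOn (sigmaObjClass C) 3 P h_K w` — ⟹ `WeilClassesComponent 3 d δ` (HC for the Weil classes on
that component of the `g = 6` Weil locus).  Nothing asserted; no row of the cell's census certifies such a seed.
[claim: Perry2026Semiregularity, status: under-review] [cite: Perry2022, Prop. 8.1] [cite: Pridham2024Semiregularity, Cor. 2.25, Rem. 2.27]
[cite: BuchweitzFlenner2003, Def. 4.1 and §5 (I-semiregular)] [cite: Deligne1982HodgeCycles, proof of Thm. 4.8] -/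
theorem weilSixfoldComponent_of_perfectComplexSigmaTransfer_of_seedOn_member (C : ChernCharacterBetti) {d : ℕ}
    {δ : weilNormResidueGroup d} (hF : weilFamilyReach_similar) (hT : PerfectComplexSigmaTransfer C)
    {P : AbelianVariety ℂ} {ψ₀ : P ⟶ P} (hW : IsWeilType P ψ₀ 3 d) (e : ProjectiveEmbedding P.X)
    {a : complexBetti (projectiveSpace e.n ℂ) 2} (haQ : IsRationalClass a) (ha0 : a ≠ 0)
    (hδ : HasWeilDiscriminantNondeg P ψ₀ 3 d (symmetrisedClass d P ψ₀ e a) δ)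
    {w : complexBetti P.X 6} (hwW : w ∈ weilClassesOf P ψ₀ 3 d) (hwQ : IsRationalClass w) (hw0 : w ≠ 0)
    (hS : HasSeedOn (sigmaObjClass C) 3 P (symmetrisedClass d P ψ₀ e a) w) :
    WeilClassesComponent 3 d δ :=
  weilClassesComponent_of_perfectComplexSigmaTransfer_of_seedOn_member C hF hT hW e haQ ha0 hδ hwW hwQ hw0 hS

/-- **`g = 4`, route (C) over the semiregularity class.** Hypotheses BY NAME: `weilFamilyReach_hyperbolic` (refereed fact);
`PerfectComplexSigmaTransfer C` (ASSUMPTION of the venture); `0 < d`; ONE hyperbolic seed of class `sigmaObjClass C` on a split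
`ℚ(√-d)`-Weil fourfold (an `I`-semiregular bounded complex of vector bundles with `Ext^{<0} = 0`, `Hom = ℂ` and the Weil
component in `ch₂`, by value).  Conclusion: `Stubs.WeilAlgebraicSplitHyperplane 2 d` — the Weil classes of every abelian fourfold
of the split `ℚ(√-d)`-Weil component are algebraic (the case in print, re-derived; nothing about non-split components).
[claim: Perry2026Semiregularity, status: under-review] [cite: Perry2022, Prop. 8.1] [cite: Pridham2024Semiregularity, Cor. 2.25, Rem. 2.27]
[cite: Deligne1982HodgeCycles, proof of Thm. 4.8] [cite: Markman2023GeneralizedKummers, Theorem 1.3 (the case in print)] -/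
theorem weilFourfoldsSplit_of_reach_of_perfectComplexSigmaTransfer_of_hyperbolicSeedOn {C : ChernCharacterBetti}
    (hF : weilFamilyReach_hyperbolic) (hT : PerfectComplexSigmaTransfer C) {d : ℕ} (hd : 0 < d)
    (hS : HasHyperbolicSeedOn (sigmaObjClass C) 2 d) : Stubs.WeilAlgebraicSplitHyperplane 2 d :=
  weilFourfoldsSplit_of_reach_of_localVariationalHodgeFor_of_hyperbolicSeedOn hF hT.localVariationalHodgeFor hd hS

/-- **`g = 6`, route (C) over the semiregularity class, the row UNBUNDLED — every binder a real tree carrier.**  A Weil-type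
`(3, d)` member `(P, ψ₀)` of the sixfold cell `δ` with projective embedding `e`, rational `a ≠ 0` and Gram placement `hδ`; a
non-zero rational class `w` of its Weil plane; a finite set of Chern degrees `I ⊇ {1, …, 6}`; ONE cochain complex `E` of
`𝒪_P`-modules which is a bounded complex of vector bundles concentrated in `[a', b']`, with `Ext^k_{D(P)}(E, E) = 0` for `k < 0`,
`Hom(E, E) = ℂ` (`extRank`) and `(σ_q(E))_{q + 1 ∈ I}` JOINTLY INJECTIVE (`HomComplex.IsISemiregularC`, the real `σ_q` of
`HomComplexSigma.lean`, in `D(Mod 𝒪_P)` for `HasDerivedCategory.standard`); rationals `q`, `c_p` with `ch₃(E) = q·h_K³ + w` and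
`ch_p(E) = c_p·h_Kᵖ` for `p ∈ I ∖ {3}` ⟹ under `weilFamilyReach_similar` (REFEREED) and the ASSUMPTION `PerfectComplexSigmaTransfer C`:
`WeilClassesComponent 3 d δ`.  The semiregularity binder `hσ` is BY VALUE (a census certificate «σ-rank = dim Ext² on two codes»;
no computation discharges it in the kernel); nothing is asserted; no row of the census supplies these binders on a deciding
component.  [claim: Perry2026Semiregularity, status: under-review] [cite: Perry2022, Prop. 8.1]
[cite: Pridham2024Semiregularity, Cor. 2.25, Rem. 2.27] [cite: BuchweitzFlenner2003, Def. 4.1 and §5 (I-semiregular)]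
[cite: Deligne1982HodgeCycles, proof of Thm. 4.8] -/
theorem weilSixfoldComponent_of_perfectComplexSigmaTransfer_of_complex (C : ChernCharacterBetti) {d : ℕ}
    {δ : weilNormResidueGroup d} (hF : weilFamilyReach_similar) (hT : PerfectComplexSigmaTransfer C)
    {P : AbelianVariety ℂ} {ψ₀ : P ⟶ P} (hW : IsWeilType P ψ₀ 3 d) (e : ProjectiveEmbedding P.X)
    {a : complexBetti (projectiveSpace e.n ℂ) 2} (haQ : IsRationalClass a) (ha0 : a ≠ 0)
    (hδ : HasWeilDiscriminantNondeg P ψ₀ 3 d (symmetrisedClass d P ψ₀ e a) δ)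
    {w : complexBetti P.X 6} (hwW : w ∈ weilClassesOf P ψ₀ 3 d) (hwQ : IsRationalClass w) (hw0 : w ≠ 0)
    (I : Finset ℕ) (hI : ∀ p : ℕ, 1 ≤ p → p ≤ 2 * 3 → p ∈ I) (E : CochainComplex P.X.left.Modules ℤ)
    (hE : IsBoundedVBComplex E) (hneg : ∀ k : ℤ, k < 0 → extRank P.X E k = 0) (h0 : extRank P.X E 0 = 1)
    (a' b' : ℤ) [E.IsStrictlyGE a'] [E.IsStrictlyLE b']
    (hσ : letI := HasDerivedCategory.standard P.X.left.Modules
      HomComplex.IsISemiregularC P.X E a' b' hE.isFiniteLocallyFree {q | q + 1 ∈ I})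
    (q : ℚ) (c : ℕ → ℚ)
    (hch3 : chPerfect C P.X E hE.isFiniteLocallyFree 3 = ((q : ℚ) : ℂ) • cupPowTwo (symmetrisedClass d P ψ₀ e a) 3 + w)
    (hchp : ∀ p ∈ I, p ≠ 3 →
      chPerfect C P.X E hE.isFiniteLocallyFree p = ((c p : ℚ) : ℂ) • cupPowTwo (symmetrisedClass d P ψ₀ e a) p) :
    WeilClassesComponent 3 d δ :=
  weilSixfoldComponent_of_perfectComplexSigmaTransfer_of_seedOn_member C hF hT hW e haQ ha0 hδ hwW hwQ hw0
    ⟨I, fun p => chPerfect C P.X E hE.isFiniteLocallyFree p, q, c, hI 3 (by norm_num) (by norm_num),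
      ⟨E, hE, ⟨hI, hneg, h0, a', b', inferInstance, inferInstance, hE.isFiniteLocallyFree, hσ⟩, fun _ _ => rfl⟩, hch3, hchp⟩

/-- **`g = 4`, route (C) over the semiregularity class, the census row UNBUNDLED — every binder a real tree carrier** (the
`σ`-certificate form of seat p7's `weilFourfoldsSplit_of_reach_of_perfectComplexRankTransfer_of_complex`): a complex abelian
fourfold `P` with `ψ₀ ≫ ψ₀ = -d`, of SPLIT Weil type for `h_K = symmetrisedClass d P ψ₀ e a` (`a ≠ 0` rational); a non-zero rational
class `w` of the Weil plane; `I ⊇ {1, 2, 3, 4}`; ONE bounded complex of vector bundles `E` on `P.X` concentrated in `[a', b']` with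
`Ext^{<0}(E, E) = 0`, `Hom(E, E) = ℂ` and `(σ_q(E))_{q + 1 ∈ I}` jointly injective (`HomComplex.IsISemiregularC`); rationals `q`, `c_p`
with `ch₂(E) = q·h_K² + w`, `ch_p(E) = c_p·h_Kᵖ` for `p ∈ I ∖ {2}` ⟹ under `weilFamilyReach_hyperbolic` (refereed) and the
ASSUMPTION `PerfectComplexSigmaTransfer C`, the Weil classes of EVERY split `√-d`-Weil abelian fourfold are algebraic (the case in
print, re-derived).  For the cell's STEP-0 object the census records, by value: `P = X × X̂`, `E = Φ(I_{p×X ∪ X×q}) ⊗ M_B`,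
`Ext^• = (1, 8, 18, 8, 1)`, full `σ : Ext² → ⊕_{q ≤ 2} H^{q+2}(Ω^q)` injective on two codes (`28 = 6 + 16 + 6`), `d ∈ {3, 7, 11, 15}`.
[claim: Perry2026Semiregularity, status: under-review] [cite: Perry2022, Prop. 8.1] [cite: Pridham2024Semiregularity, Cor. 2.25, Rem. 2.27]
[cite: Deligne1982HodgeCycles, proof of Thm. 4.8] [cite: Markman2025SecantWeil, §1.5 and Thm. 1.5.1 (preprint)]
[cite: Markman2023GeneralizedKummers, Theorem 1.3] -/
theorem weilFourfoldsSplit_of_reach_of_perfectComplexSigmaTransfer_of_complex {C : ChernCharacterBetti}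
    (hF : weilFamilyReach_hyperbolic) (hT : PerfectComplexSigmaTransfer C) {d : ℕ} (hd : 0 < d)
    (P : AbelianVariety ℂ) (ψ₀ : P ⟶ P) (e : ProjectiveEmbedding P.X) (a : complexBetti (projectiveSpace e.n ℂ) 2)
    (hP : P.dim = 2 * 2) (hψ : ψ₀ ≫ ψ₀ = -(d • 𝟙 P)) (ha : IsRationalClass a) (ha0 : a ≠ 0)
    (hhyp : IsHyperbolicWeilType P ψ₀ 2 (symmetrisedClass d P ψ₀ e a))
    (w : complexBetti P.X (2 * 2)) (hwW : w ∈ weilClassesOf P ψ₀ 2 d) (hwr : IsRationalClass w) (hw0 : w ≠ 0)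
    (I : Finset ℕ) (hI : ∀ p : ℕ, 1 ≤ p → p ≤ 2 * 2 → p ∈ I) (E : CochainComplex P.X.left.Modules ℤ)
    (hE : IsBoundedVBComplex E) (hneg : ∀ k : ℤ, k < 0 → extRank P.X E k = 0) (h0 : extRank P.X E 0 = 1)
    (a' b' : ℤ) [E.IsStrictlyGE a'] [E.IsStrictlyLE b']
    (hσ : letI := HasDerivedCategory.standard P.X.left.Modules
      HomComplex.IsISemiregularC P.X E a' b' hE.isFiniteLocallyFree {q | q + 1 ∈ I})
    (q : ℚ) (c : ℕ → ℚ)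
    (hch2 : chPerfect C P.X E hE.isFiniteLocallyFree 2 = ((q : ℚ) : ℂ) • cupPowTwo (symmetrisedClass d P ψ₀ e a) 2 + w)
    (hchp : ∀ p ∈ I, p ≠ 2 →
      chPerfect C P.X E hE.isFiniteLocallyFree p = ((c p : ℚ) : ℂ) • cupPowTwo (symmetrisedClass d P ψ₀ e a) p) :
    Stubs.WeilAlgebraicSplitHyperplane 2 d :=
  weilFourfoldsSplit_of_reach_of_perfectComplexVariationalHodge_of_complex hF ((perfectComplexSigmaTransfer_iff C).1 hT) hd
    P ψ₀ e a hP hψ ha ha0 hhyp w hwW hwr hw0 I (hI 2 (by norm_num) (by norm_num)) E hE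
    ⟨hI, hneg, h0, a', b', inferInstance, inferInstance, hE.isFiniteLocallyFree, hσ⟩ q c hch2 hchp

end Consumers

end Summit.Ventures.HSemireg

end
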